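import Summits.Parity.GeneralizedHardyLittlewood.Theorems.LiouvilleShiftedTablesEngineToPairsSieveCaseBoxed
import Summits.Parity.GeneralizedHardyLittlewood.Theorems.LiouvilleShiftedTablesEngineToPairsSieveDispatchI2

/-!
# Correlation sieve for line `Sketch` of the crux `EngineToPairs` (stmt-Parity-14659), part 7a:
# tools for a tuple with two high smooth factors (one of them, a `ζ` factor, left unboxed)

Support file for the stub `stub_sieve : CorrelationSieveFamily`, continuing parts 6a and 3b.  When the
set `L` of high smooth indices has two elements `{s, t}` (with `t` a `ζ` index), the factor `t` is left
UNBOXED (`selF V U j L t = 1_{(V, ∞)}`) and the others are boxed (`gF … κ i`, `i ≠ t`).  Tools: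

* `corrFun_prod_mul_units_le` — discarding unit boxes in `(∏_{i∈I} g_i) ⋆ H`;
* `abs_prod_gF_mul_le` — `|((∏_{S} gF) ⋆ H)(n)| ≤ log x · tauPow 6 n` for `#S ≤ 5`, `|H| ≤ 1`;
* `selF_high_zeta_apply` — the unboxed high `ζ` factor is `n ↦ 1_{V < n}`; `indAF`, `indAF_apply` and
  `selF_high_zeta_eq_indAF` — on `[1, ⌊x⌋]` it is the indicator of `[⌊V⌋+1, ⌊x⌋]`;
* `gF_eq_zero_of_high_of_boxLow_lt_one` — a high factor whose box lies below `1` vanishes (`1 ≤ V`);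
* `exists_pair_of_mul_apply_ne_zero` — `(F ⋆ H)(n) ≠ 0` gives `a b = n` with `F a ≠ 0`, `H b ≠ 0`.
-/

noncomputable section

namespace Summit.Parity.GeneralizedHardyLittlewood.Theorems.EngineToPairs.Sieve

open Finset Real
open scoped ArithmeticFunction.zeta ArithmeticFunction.Moebius ArithmeticFunction.sigma
open Literature.NumberTheory.Sieve Literature.NumberTheory.Sieve.BFI

/-! ### Units, with an extra factor -/

/-- **Discarding units (with an extra factor).**  For boxed factors `g_i = boxRestrict x 1 (κ i) (F i)`
(`i ∈ I`) with `|g_i(1)| ≤ 1` and any `H`: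
`∑_q |corrFun (w q) x ((∏_{i∈I} g_i) ⋆ H)| ≤ ∑_q |corrFun (w q) x ((∏_{i∈I, 1 ≤ lo_i} g_i) ⋆ H)|`. [this line] -/
theorem corrFun_prod_mul_units_le {ι : Type*} [DecidableEq ι] (I : Finset ι) (Qs : Finset ℕ)
    (w : ℕ → ℕ → ℝ) (x : ℝ) (κ : ι → ℕ) (F : ι → ArithmeticFunction ℝ) (H : ArithmeticFunction ℝ)
    (hF1 : ∀ i ∈ I, |boxRestrict x 1 (κ i) (F i) 1| ≤ 1) :
    ∑ q ∈ Qs, |corrFun (w q) x (fun n => ((∏ i ∈ I, boxRestrict x 1 (κ i) (F i)) * H) n)| ≤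
      ∑ q ∈ Qs, |corrFun (w q) x (fun n =>
        ((∏ i ∈ I.filter (fun i => (1 : ℝ) ≤ boxLow x 1 (κ i)), boxRestrict x 1 (κ i) (F i)) * H) n)| := by
  classical
  set Un := I.filter (fun i : ι => ¬ (1 : ℝ) ≤ boxLow x 1 (κ i)) with hUn
  set Gen := I.filter (fun i : ι => (1 : ℝ) ≤ boxLow x 1 (κ i)) with hGen
  set c : ℝ := ∏ i ∈ Un, boxRestrict x 1 (κ i) (F i) 1 with hc
  have hsplit : (∏ i ∈ I, boxRestrict x 1 (κ i) (F i)) * H =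
      (∏ i ∈ Un, boxRestrict x 1 (κ i) (F i)) * ((∏ i ∈ Gen, boxRestrict x 1 (κ i) (F i)) * H) := by
    rw [← mul_assoc, hUn, hGen, mul_comm (∏ i ∈ I.filter _, _), Finset.prod_filter_mul_prod_filter_not]
  have hunit : ∀ i ∈ Un, ∀ n, n ≠ 1 → boxRestrict x 1 (κ i) (F i) n = 0 := by
    intro i hi n hn
    have hlt : boxLow x 1 (κ i) < 1 := not_le.1 (Finset.mem_filter.1 hi).2
    exact box_eq_zero_of_boxLow_lt_one hlt (F i) hn
  have hc1 : |c| ≤ 1 := by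
    rw [hc, Finset.abs_prod]
    exact Finset.prod_le_one (fun i _ => abs_nonneg _) fun i hi => hF1 i (Finset.mem_filter.1 hi).1
  refine Finset.sum_le_sum fun q _ => ?_
  have heq : corrFun (w q) x (fun n => ((∏ i ∈ I, boxRestrict x 1 (κ i) (F i)) * H) n) =
      c * corrFun (w q) x (fun n => ((∏ i ∈ Gen, boxRestrict x 1 (κ i) (F i)) * H) n) := by
    rw [← corrFun_smul]
    refine corrFun_congr fun n _ => ?_
    rw [hsplit, prod_mul_apply_of_support_one Un _ hunit]
  rw [heq, abs_mul]
  exact mul_le_of_le_one_left (abs_nonneg _) hc1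

/-! ### Coefficient bound with an extra bounded factor -/

/-- For `#S ≤ 5` and `|H| ≤ 1` pointwise: `|((∏_{i∈S} gF i) ⋆ H)(n)| ≤ log x · tauPow 6 n`. [this line] -/
theorem abs_prod_gF_mul_le {δ x : ℝ} (hLx : Large δ x) {U j : ℕ} (hj : 1 ≤ j) (L : Finset (Fin (2 * j)))
    (κ : Fin (2 * j) → ℕ) (S : Finset (Fin (2 * j))) (hS : S.card ≤ 5) (H : ArithmeticFunction ℝ)
    (hH : ∀ n, |H n| ≤ 1) (n : ℕ) : |((∏ i ∈ S, gF x U j L κ i) * H) n| ≤ Real.log x * tauPow 6 n := by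
  classical
  have hlog1 : 1 ≤ Real.log x := hLx.one_le_log
  rcases Nat.eq_zero_or_pos n with rfl | hn
  · simp only [ArithmeticFunction.map_zero, abs_zero]
    exact mul_nonneg hLx.log_pos.le (tauPow_nonneg 6 0)
  set A : Fin (2 * j) → ℝ := fun i => if i.val = 2 * j - 1 then Real.log x else 1 with hA
  have hA1 : ∀ i ∈ S, 1 ≤ A i := fun i _ => by simp only [hA]; split_ifs <;> [exact hlog1; exact le_rfl]
  have hF : ∀ d, |(∏ i ∈ S, gF x U j L κ i) d| ≤ (∏ i ∈ S, A i) * ((σ 0 d : ℕ) : ℝ) ^ S.card := fun d =>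
    abs_prod_apply_le_of_abs_le S (gF x U j L κ) A hA1 (fun i _ m => abs_gF_le hLx hj L κ i m) d
  have hprodA0 : 0 ≤ ∏ i ∈ S, A i := Finset.prod_nonneg fun i hi => zero_le_one.trans (hA1 i hi)
  have h := abs_mul_apply_le_sigma_zero_pow (F := ∏ i ∈ S, gF x U j L κ i) (G := H) (A := ∏ i ∈ S, A i)
    (B := 1) (a := S.card) (b := 0) hprodA0 zero_le_one hF
    (fun e => by rw [pow_zero, mul_one]; exact hH e) n
  have hprodA : ∏ i ∈ S, A i ≤ Real.log x := by
    by_cases hmem : ∃ i ∈ S, i.val = 2 * j - 1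
    · obtain ⟨i₀, hi₀, hi₀v⟩ := hmem
      rw [← Finset.mul_prod_erase S A hi₀]
      have hrest : ∏ i ∈ S.erase i₀, A i = 1 := by
        refine Finset.prod_eq_one fun i hi => ?_
        have hne : i ≠ i₀ := Finset.ne_of_mem_erase hi
        have : i.val ≠ 2 * j - 1 := fun h => hne (Fin.ext (by rw [h, hi₀v]))
        simp [hA, this]
      rw [hrest, mul_one]; simp [hA, hi₀v]
    · push Not at hmem
      rw [Finset.prod_eq_one (fun i hi => by simp [hA, hmem i hi])]; exact hlog1
  have hτ : ((σ 0 n : ℕ) : ℝ) ^ (S.card + 0 + 1) ≤ tauPow 6 n := by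
    rw [sigma_zero_pow_eq_tauPow]; exact tauPow_le_tauPow (by omega) (by omega) n
  calc |((∏ i ∈ S, gF x U j L κ i) * H) n| ≤ (∏ i ∈ S, A i) * 1 * ((σ 0 n : ℕ) : ℝ) ^ (S.card + 0 + 1) := h
    _ ≤ Real.log x * tauPow 6 n := by
        rw [mul_one]; exact mul_le_mul hprodA hτ (by positivity) hLx.log_pos.le

/-! ### The unboxed high `ζ` factor -/

/-- A high (`∈ L`) smooth non-`log` factor is `n ↦ 1_{V < n}` (`V ≥ 0`). [this line] -/
theorem selF_high_zeta_apply {V : ℝ} (hV : 0 ≤ V) {U j : ℕ} {L : Finset (Fin (2 * j))} {t : Fin (2 * j)}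
    (ht1 : j ≤ t.val) (ht2 : t.val ≠ 2 * j - 1) (htL : t ∈ L) (n : ℕ) :
    selF V U j L t n = if V < (n : ℝ) then 1 else 0 := by
  unfold selF splitSel
  rw [if_pos (mem_smoothIdx.2 ht1), if_pos htL, splitHigh_apply]
  rcases Nat.eq_zero_or_pos n with rfl | hn
  · simp only [Nat.cast_zero, hV, if_true, ArithmeticFunction.map_zero]
    rw [if_neg (not_lt.2 hV)]
  · rw [hbF_zeta_apply ht1 ht2 hn.ne']
    by_cases h : (n : ℝ) ≤ V
    · rw [if_pos h, if_neg (not_lt.2 h)]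
    · rw [if_neg h, if_pos (not_le.1 h)]

/-- The indicator of the integer interval `[a+1, b]` as an arithmetic function. [this line] -/
def indAF (a b : ℕ) : ArithmeticFunction ℝ where
  toFun n := if a + 1 ≤ n ∧ n ≤ b then 1 else 0
  map_zero' := by simp

/-- Unfolding `indAF`. [folklore] -/
theorem indAF_apply (a b n : ℕ) : indAF a b n = if a + 1 ≤ n ∧ n ≤ b then 1 else 0 := rfl

/-- On `[1, ⌊x⌋]` the unboxed high `ζ` factor is the indicator of `[⌊V⌋+1, ⌊x⌋]`. [this line] -/
theorem selF_high_zeta_eq_indAF {x V : ℝ} (hV : 0 ≤ V) {U j : ℕ} {L : Finset (Fin (2 * j))} {t : Fin (2 * j)}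
    (ht1 : j ≤ t.val) (ht2 : t.val ≠ 2 * j - 1) (htL : t ∈ L) (n : ℕ) (hn : (n : ℝ) ≤ x) :
    selF V U j L t n = indAF ⌊V⌋₊ ⌊x⌋₊ n := by
  rw [selF_high_zeta_apply hV ht1 ht2 htL n, indAF_apply]
  have hnx : n ≤ ⌊x⌋₊ := by
    rcases Nat.eq_zero_or_pos n with rfl | hn0
    · exact Nat.zero_le _
    · exact Nat.le_floor hn
  by_cases h : V < (n : ℝ)
  · rw [if_pos h, if_pos ⟨Nat.succ_le_of_lt ((Nat.floor_lt hV).2 h), hnx⟩]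
  · rw [if_neg h, if_neg]
    rintro ⟨h1, -⟩
    exact h ((Nat.floor_lt hV).1 (Nat.lt_of_succ_le h1))

/-- A high smooth factor whose box lies below `1` vanishes identically (`1 ≤ V`). [folklore] -/
theorem gF_eq_zero_of_high_of_boxLow_lt_one {x V' : ℝ} {U j : ℕ} {L : Finset (Fin (2 * j))}
    {κ : Fin (2 * j) → ℕ} {s : Fin (2 * j)} (hs1 : j ≤ s.val) (hsL : s ∈ L) (hV1 : 1 ≤ V')
    (hV : V' = x ^ ((9 : ℝ) / 20)) (hlo : boxLow x 1 (κ s) < 1) (n : ℕ) : gF x U j L κ s n = 0 := by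
  by_cases hn : n = 1
  · subst hn
    unfold gF
    rw [boxRestrict_apply]
    split_ifs with hin
    · unfold selF splitSel
      rw [if_pos (mem_smoothIdx.2 hs1), if_pos hsL, splitHigh_apply, if_pos]
      rw [Nat.cast_one, ← hV]; exact hV1
    · rfl
  · exact box_eq_zero_of_boxLow_lt_one hlo _ hn

/-- `(F ⋆ H)(n) ≠ 0` gives a factorisation `a b = n` with `F a ≠ 0`, `H b ≠ 0`. [folklore] -/
theorem exists_pair_of_mul_apply_ne_zero {F H : ArithmeticFunction ℝ} {n : ℕ} (h : (F * H) n ≠ 0) :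
    ∃ a b : ℕ, a * b = n ∧ F a ≠ 0 ∧ H b ≠ 0 := by
  rw [ArithmeticFunction.mul_apply] at h
  obtain ⟨p, hp, hp0⟩ := Finset.exists_ne_zero_of_sum_ne_zero h
  exact ⟨p.1, p.2, (Nat.mem_divisorsAntidiagonal.1 hp).1, left_ne_zero_of_mul hp0, right_ne_zero_of_mul hp0⟩

end Summit.Parity.GeneralizedHardyLittlewood.Theorems.EngineToPairs.Sieve

namespace Summit.Parity.GeneralizedHardyLittlewood.Theorems.EngineToPairs

/-- Registered sub-goal of `stub_sieve` carried by this part (landing mechanics): unfolding the interval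
indicator `indAF`. [folklore] -/
theorem sieve_part7a_anchor : ∀ (a b n : ℕ), Summit.Parity.GeneralizedHardyLittlewood.Theorems.EngineToPairs.Sieve.indAF a b n = if a + 1 ≤ n ∧ n ≤ b then 1 else 0 :=
  Sieve.indAF_apply

end Summit.Parity.GeneralizedHardyLittlewood.Theorems.EngineToPairs

end
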